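import Mathlib.RingTheory.MvPolynomial.Basic
import Mathlib.Algebra.MvPolynomial.CommRing
import Mathlib.LinearAlgebra.Matrix.Adjugate
import Mathlib.LinearAlgebra.FiniteDimensional.Basic
import Mathlib.LinearAlgebra.Matrix.FiniteDimensional
import Mathlib.Algebra.Algebra.Subalgebra.Basic
import HarnessLib

/-!
# The variety of conjugate tuples with product one and its parametrisation by `GL_n × ∏ᵢ C(Tᵢ)`

Topic `Literature/AlgebraicGeometry/Motives`; the algebraic geometry behind the direction
"linearly rigid ⟹ index of rigidity `2`" of Katz's rigidity criterion ([Katz1996, Thm. 1.1.2];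
[DettweilerReiter2000, Lemma 4.7]; general characteristic [StrambachVolklein1999]), in the form
printed in [Haraoka2020, Thm. 7.8, third part of the proof]: for a tuple `T = (Tᵢ)_{i<r}` in
`GL_n(K)` with `∏ᵢ Tᵢ = 1`, the group `G = GL_n × ∏ᵢ Z(Tᵢ)` acts on
`U = GL_n^r` by `(Cᵢ) ↦ (D Cᵢ Zᵢ⁻¹)` preserving the fibre `π⁻¹(1)` of
`π : U → SL_n`, `(Cᵢ) ↦ ∏ᵢ Cᵢ Tᵢ Cᵢ⁻¹`, transitively if `T` is linearly rigid, whence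
`dim G ≥ dim π⁻¹(1) ≥ r n² - (n² - 1)`.  This file sets up the two AFFINE COORDINATE RINGS and
the comorphism, entirely inside polynomial rings (no localisation is needed: see
`ConjugateTupleVarietyDimension.lean` for the dimension count):

* `TuplePoly K r n = K[x^{(i)}_{jk}]` (coordinates on `M_n^r`), the generic matrices
  `genMatrix i = Xᵢ`, `detProd = f = ∏ᵢ det Xᵢ`, `prodMatrix T = M = ∏ᵢ Xᵢ Tᵢ adj(Xᵢ)` (so that
  `∏ᵢ Xᵢ Tᵢ Xᵢ⁻¹ = f⁻¹ M` on `GL_n^r`), and the `n² - 1` polynomial equations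
  `fibreGens T e = {M_{jk} - f δ_{jk} | (j,k) ≠ (e,e)}` of the fibre (the omitted diagonal
  equation follows from `det M = fⁿ`); `pointMatrix x` reads a `K`-point as a tuple of matrices;
* `GroupPoly T = K[d_{jk}, z_{i,a}]` (coordinates on `M_n × ∏ᵢ C(Tᵢ)`, `cdim T i = dim C(Tᵢ)`,
  `cbasis` a basis `E_{i,a}` of `C(Tᵢ)`), the generic matrices `genD = D`,
  `genZ i = Zᵢ = Σₐ z_{i,a} E_{i,a}`, the comorphism `comorph T = φ* : Xᵢ ↦ D Zᵢ` of the orbit map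
  and the `K`-points `gpoint D₀ W` of `G`;
* the identities `φ*(M) = (∏ᵢ det(D Zᵢ)) • 1` (`map_comorph_prodMatrix_eq`: `Zᵢ` commutes with
  `Tᵢ`, `Z adj Z = det Z`, and `(∏ᵢ D Aᵢ adj D) D = (det D)^r D ∏ᵢ Aᵢ`), hence
  `(fibreGens) ⊆ ker φ*` (`span_fibreGens_le_ker`) and `f ∉ ker φ*` (`detProd_not_mem_ker`, by
  evaluating at `(1, 1)`), and the dimensions `dim K[x] = r n²`, `dim K[d, z] = n² + Σᵢ cᵢ`.

## References
* [Haraoka2020] Y. Haraoka, *Linear Differential Equations in the Complex Domain*, LNM 2271,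
  proof of Thm. 7.8 (pp. 153–154); [StrambachVolklein1999]; [Katz1996] Thm. 1.1.2;
  [DettweilerReiter2000] Lemma 4.7.
-/

noncomputable section

namespace Literature.AlgebraicGeometry.Motives

namespace RigidTuple

open MvPolynomial Matrix Module

universe u

variable (K : Type u) [Field K] (r n : ℕ)

/-- Coordinates on `M_n(K)^r`: the variable `(i, j, k)` is the `(j, k)` entry of the `i`-th
matrix. [folklore] -/
abbrev TupleVars : Type := Fin r × Fin n × Fin n

/-- The coordinate ring `K[x^{(i)}_{jk}]` of `M_n^r`. [folklore] -/
abbrev TuplePoly : Type u := MvPolynomial (TupleVars r n) K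

/-- The `i`-th generic matrix `X_i = (x^{(i)}_{jk})_{jk}` over `K[x]`. [folklore] -/
def genMatrix (i : Fin r) : Matrix (Fin n) (Fin n) (TuplePoly K r n) :=
  Matrix.of fun j k => X (i, j, k)

/-- `f = ∏ᵢ det X_i`, the equation of the complement of `GL_n^r` in `M_n^r`. [folklore] -/
def detProd : TuplePoly K r n := ∏ i, (genMatrix K r n i).det

variable {K r n}
variable (T : Fin r → Matrix (Fin n) (Fin n) K)

/-- `M = ∏ᵢ X_i T_i adj(X_i)` (ordered product), the numerator of `∏ᵢ X_i T_i X_i⁻¹ = f⁻¹ M`.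
[folklore] -/
def prodMatrix : Matrix (Fin n) (Fin n) (TuplePoly K r n) :=
  (List.ofFn fun i => genMatrix K r n i * (T i).map C * (genMatrix K r n i).adjugate).prod

/-- The `n² - 1` equations `M_{jk} = f δ_{jk}`, `(j, k) ≠ (e, e)`, cutting out (inside `GL_n^r`) the
variety `Y = {(C_i) | ∏ᵢ C_i T_i C_i⁻¹ = 1}` when `det (∏ T_i) = 1` (the omitted diagonal equation
follows from `det M = fⁿ`). [folklore] -/
def fibreGens [DecidableEq (TuplePoly K r n)] (e : Fin n) : Finset (TuplePoly K r n) :=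
  ((Finset.univ : Finset (Fin n × Fin n)).erase (e, e)).image fun jk =>
    prodMatrix T jk.1 jk.2 - detProd K r n * (1 : Matrix (Fin n) (Fin n) (TuplePoly K r n)) jk.1 jk.2

/-- There are at most `n² - 1` fibre equations. [folklore] -/
theorem card_fibreGens_le [DecidableEq (TuplePoly K r n)] (e : Fin n) :
    (fibreGens T e).card ≤ n * n - 1 := by
  refine Finset.card_image_le.trans ?_
  rw [Finset.card_erase_of_mem (Finset.mem_univ _), Finset.card_univ, Fintype.card_prod,
    Fintype.card_fin]

/-! ### The group side: `G = GL_n × ∏ᵢ C(T_i)^×` -/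

/-- `c_i = dim C(T_i)`, the dimension of the centraliser of `T_i` in `M_n(K)`. [folklore] -/
def cdim (i : Fin r) : ℕ :=
  finrank K (Subalgebra.centralizer K ({T i} : Set (Matrix (Fin n) (Fin n) K)))

/-- A basis `(E_{i,a})_a` of the centraliser `C(T_i)`. [folklore] -/
def cbasis (i : Fin r) :
    Basis (Fin (cdim T i)) K (Subalgebra.centralizer K ({T i} : Set (Matrix (Fin n) (Fin n) K))) :=
  Module.finBasis K _

/-- Coordinates on `G = GL_n × ∏ᵢ C(T_i)`: entries `d_{jk}` of `D` and coordinates `z_{i,a}` of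
`Z_i = Σ_a z_{i,a} E_{i,a} ∈ C(T_i)`. [folklore] -/
abbrev GroupVars : Type := (Fin n × Fin n) ⊕ (Σ i : Fin r, Fin (cdim T i))

/-- The coordinate ring `K[d, z]` of `M_n × ∏ᵢ C(T_i)`. [folklore] -/
abbrev GroupPoly : Type u := MvPolynomial (GroupVars T) K

/-- The generic matrix `D = (d_{jk})`. [folklore] -/
def genD : Matrix (Fin n) (Fin n) (GroupPoly T) :=
  Matrix.of fun j k => X (Sum.inl (j, k))

/-- The generic element `Z_i = Σ_a z_{i,a} E_{i,a}` of the centraliser `C(T_i)`. [folklore] -/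
def genZ (i : Fin r) : Matrix (Fin n) (Fin n) (GroupPoly T) :=
  ∑ a : Fin (cdim T i), (X (Sum.inr ⟨i, a⟩ : GroupVars T) : GroupPoly T) •
    ((cbasis T i a : Matrix (Fin n) (Fin n) K).map C)

/-- The comorphism `φ* : K[x] → K[d, z]`, `X_i ↦ D Z_i`, of the orbit map
`(D, (Z_i)) ↦ (D Z_i)ᵢ`. [folklore] -/
def comorph : TuplePoly K r n →ₐ[K] GroupPoly T :=
  MvPolynomial.aeval fun v => (genD T * genZ T v.1) v.2.1 v.2.2

/-! ### Basic identities -/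

/-- `Zᵢ` commutes with `Tᵢ` (it is a combination of elements of `C(Tᵢ)`). [folklore] -/
theorem genZ_mul_map (i : Fin r) :
    genZ T i * (T i).map C = (T i).map C * genZ T i := by
  unfold genZ
  rw [Finset.sum_mul, Finset.mul_sum]
  refine Finset.sum_congr rfl fun a _ => ?_
  rw [smul_mul_assoc, mul_smul_comm]
  congr 1
  have hmem := (cbasis T i a).2
  rw [Subalgebra.mem_centralizer_iff] at hmem
  have h := hmem (T i) rfl
  -- `T_i E = E T_i` in `M_n(K)`, mapped to `K[d, z]`
  have := congrArg (fun M : Matrix (Fin n) (Fin n) K => M.map (C : K →+* GroupPoly T)) h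
  simpa [Matrix.map_mul] using this.symm

/-- `φ*(Xᵢ) = D Zᵢ`. [folklore] -/
theorem map_comorph_genMatrix (i : Fin r) :
    (genMatrix K r n i).map (comorph T) = genD T * genZ T i := by
  ext j k
  simp [genMatrix, comorph]

/-- `φ*` is the identity on constant matrices. [folklore] -/
theorem map_comorph_map_C (S : Matrix (Fin n) (Fin n) K) :
    (S.map (C : K →+* TuplePoly K r n)).map (comorph T) = S.map C := by
  ext j k
  simp [comorph]

/-- `φ*(f) = ∏ᵢ det(D Zᵢ)`. [folklore] -/
theorem comorph_detProd :
    comorph T (detProd K r n) = ∏ i, (genD T * genZ T i).det := by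
  unfold detProd
  rw [map_prod]
  refine Finset.prod_congr rfl fun i _ => ?_
  rw [← map_comorph_genMatrix]
  exact RingHom.map_det (comorph T : TuplePoly K r n →+* GroupPoly T) _


/-- `φ*(M) = ∏ᵢ (D Zᵢ) Tᵢ adj(D Zᵢ)`. [folklore] -/
theorem map_comorph_prodMatrix :
    (prodMatrix T).map (comorph T) =
      (List.ofFn fun i => genD T * genZ T i * (T i).map C * (genD T * genZ T i).adjugate).prod := by
  unfold prodMatrix
  have h := map_list_prod ((comorph T : TuplePoly K r n →+* GroupPoly T).mapMatrix :
      Matrix (Fin n) (Fin n) (TuplePoly K r n) →+* Matrix (Fin n) (Fin n) (GroupPoly T))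
    (List.ofFn fun i => genMatrix K r n i * (T i).map C * (genMatrix K r n i).adjugate)
  rw [RingHom.mapMatrix_apply, List.map_ofFn] at h
  refine h.trans ?_
  congr 1
  refine List.ofFn_inj.2 (funext fun i => ?_)
  have hadj := RingHom.map_adjugate (comorph T : TuplePoly K r n →+* GroupPoly T)
    (genMatrix K r n i)
  rw [RingHom.mapMatrix_apply, RingHom.mapMatrix_apply, RingHom.coe_coe,
    map_comorph_genMatrix] at hadj
  simp only [Function.comp_apply, map_mul, RingHom.mapMatrix_apply, RingHom.coe_coe,
    map_comorph_genMatrix, map_comorph_map_C, hadj]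

/-! ### Two lemmas on products of matrices -/

section MatrixLemmas

variable {S : Type*} [CommRing S] {m : Type*} [Fintype m] [DecidableEq m] {ι : Type*}

/-- `∏ (cᵢ • Mᵢ) = (∏ cᵢ) • ∏ Mᵢ` for an ordered product of matrices. [folklore] -/
theorem list_prod_map_smul (c : ι → S) (M : ι → Matrix m m S) (l : List ι) :
    (l.map fun i => c i • M i).prod = (l.map c).prod • (l.map M).prod := by
  induction l with
  | nil => simp
  | cons a l ih =>
    rw [List.map_cons, List.map_cons, List.map_cons, List.prod_cons, List.prod_cons,
      List.prod_cons, ih, smul_mul_smul_comm]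

/-- `(∏ᵢ D Aᵢ adj(D)) D = (det D)^{#l} • D ∏ᵢ Aᵢ`: conjugation by `D` "up to `det D`" is
multiplicative. [folklore] -/
theorem list_prod_map_conj_adjugate_mul (D : Matrix m m S) (l : List (Matrix m m S)) :
    (l.map fun A => D * A * D.adjugate).prod * D = D.det ^ l.length • (D * l.prod) := by
  induction l with
  | nil => simp
  | cons A l ih =>
    rw [List.map_cons, List.prod_cons, List.prod_cons, List.length_cons, mul_assoc, ih,
      mul_smul_comm, pow_succ, mul_smul]
    congr 1
    rw [show D * A * D.adjugate * (D * l.prod) = D * A * (D.adjugate * D) * l.prod by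
      simp only [mul_assoc], Matrix.adjugate_mul, Matrix.mul_smul, Matrix.mul_one,
      Matrix.smul_mul, mul_assoc]

end MatrixLemmas

/-! ### The key identity `φ*(M) = (∏ᵢ det(D Zᵢ)) • 1` -/

/-- The `K`-point `(D₀, (Wᵢ)ᵢ)` of `G = GL_n × ∏ᵢ C(Tᵢ)` in the coordinates `(d, z)`. [folklore] -/
def gpoint (D₀ : Matrix (Fin n) (Fin n) K)
    (W : ∀ i, Subalgebra.centralizer K ({T i} : Set (Matrix (Fin n) (Fin n) K))) :
    GroupVars T → K :=
  Sum.elim (fun jk => D₀ jk.1 jk.2) (fun ia => (cbasis T ia.1).repr (W ia.1) ia.2)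

/-- At the point `(D₀, W)` the generic matrix `D` evaluates to `D₀`. [folklore] -/
theorem eval_gpoint_genD (D₀ : Matrix (Fin n) (Fin n) K)
    (W : ∀ i, Subalgebra.centralizer K ({T i} : Set (Matrix (Fin n) (Fin n) K))) :
    (genD T).map (eval (gpoint T D₀ W)) = D₀ := by
  ext j k
  simp [genD, gpoint]

/-- At the point `(D₀, W)` the generic matrix `Zᵢ` evaluates to `Wᵢ`. [folklore] -/
theorem eval_gpoint_genZ (D₀ : Matrix (Fin n) (Fin n) K)
    (W : ∀ i, Subalgebra.centralizer K ({T i} : Set (Matrix (Fin n) (Fin n) K))) (i : Fin r) :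
    (genZ T i).map (eval (gpoint T D₀ W)) = W i := by
  have h := (cbasis T i).sum_repr (W i)
  have h' := congrArg (Subalgebra.val _) h
  rw [map_sum] at h'
  simp only [map_smul, Subalgebra.coe_val] at h'
  ext j k
  have hjk := congrFun (congrFun h' j) k
  simp only [Matrix.sum_apply, Matrix.smul_apply, smul_eq_mul] at hjk
  simp only [genZ, Matrix.map_apply, Matrix.sum_apply, Matrix.smul_apply, smul_eq_mul, map_sum,
    map_mul, eval_X, eval_C, gpoint, Sum.elim_inr]
  exact hjk

/-- Evaluation at `(D₀, W)` after `φ*` is evaluation at the tuple `(D₀ Wᵢ)ᵢ`. [folklore] -/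
theorem eval_gpoint_comp_comorph (D₀ : Matrix (Fin n) (Fin n) K)
    (W : ∀ i, Subalgebra.centralizer K ({T i} : Set (Matrix (Fin n) (Fin n) K))) :
    (eval (gpoint T D₀ W)).comp (comorph T : TuplePoly K r n →+* GroupPoly T) =
      eval fun v => (D₀ * (W v.1 : Matrix (Fin n) (Fin n) K)) v.2.1 v.2.2 := by
  refine MvPolynomial.ringHom_ext (fun a => by simp [comorph]) fun v => ?_
  rw [RingHom.comp_apply, RingHom.coe_coe, eval_X, comorph, aeval_X]
  have h1 : (eval (gpoint T D₀ W)).mapMatrix (genD T * genZ T v.1) =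
      D₀ * (W v.1 : Matrix (Fin n) (Fin n) K) := by
    rw [map_mul, RingHom.mapMatrix_apply, RingHom.mapMatrix_apply, eval_gpoint_genD,
      eval_gpoint_genZ]
  have := congrFun (congrFun h1 v.2.1) v.2.2
  rw [RingHom.mapMatrix_apply, Matrix.map_apply] at this
  exact this

/-- The point `(D, Z) = (1, (1)ᵢ)` of `G`. [folklore] -/
abbrev unitPoint : GroupVars T → K := gpoint T 1 fun _ => 1

/-- `D(1, 1) = 1`. [folklore] -/
theorem eval_unitPoint_genD : (genD T).map (eval (unitPoint T)) = 1 :=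
  eval_gpoint_genD T 1 _

/-- `Zᵢ(1, 1) = 1`. [folklore] -/
theorem eval_unitPoint_genZ (i : Fin r) : (genZ T i).map (eval (unitPoint T)) = 1 :=
  (eval_gpoint_genZ T 1 (fun _ => 1) i).trans rfl

/-- `det D ≠ 0` in `K[d, z]`. [folklore] -/
theorem det_genD_ne_zero : (genD T).det ≠ 0 := by
  intro h
  have := RingHom.map_det (eval (unitPoint T)) (genD T)
  rw [h, map_zero, RingHom.mapMatrix_apply, eval_unitPoint_genD, det_one] at this
  exact zero_ne_one this

/-- `det(D Zᵢ)(1, 1) = 1`. [folklore] -/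
theorem eval_unitPoint_det (i : Fin r) : eval (unitPoint T) (genD T * genZ T i).det = 1 := by
  rw [RingHom.map_det, RingHom.mapMatrix_apply, Matrix.map_mul, eval_unitPoint_genD,
    eval_unitPoint_genZ, one_mul, det_one]

/-- `φ*(f) ≠ 0`: the orbit map lands in `GL_n^r`. [folklore] -/
theorem comorph_detProd_ne_zero : comorph T (detProd K r n) ≠ 0 := by
  rw [comorph_detProd]
  intro h
  have := congrArg (eval (unitPoint T)) h
  rw [map_prod, map_zero, Finset.prod_congr rfl fun i _ => eval_unitPoint_det T i,
    Finset.prod_const_one] at this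
  exact one_ne_zero this

/-- `(T_i)` over `K[d, z]` still has product one. [folklore] -/
theorem prod_map_C (hT : (List.ofFn T).prod = 1) :
    (List.ofFn fun i => (T i).map (C : K →+* GroupPoly T)).prod = 1 := by
  have := map_list_prod ((C : K →+* GroupPoly T).mapMatrix :
    Matrix (Fin n) (Fin n) K →+* Matrix (Fin n) (Fin n) (GroupPoly T)) (List.ofFn T)
  rw [hT, map_one, List.map_ofFn] at this
  exact this.symm

/-- **The key identity**: `φ*(M) = ∏ᵢ (D Zᵢ) Tᵢ adj(D Zᵢ) = (∏ᵢ det(D Zᵢ)) • 1` when `∏ᵢ Tᵢ = 1`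
(`Zᵢ` commutes with `Tᵢ`, `Z adj(Z) = det Z`, and `∏ᵢ D Tᵢ adj(D) = (det D)^{r-1} D (∏ Tᵢ) adj D`).
[folklore] -/
theorem map_comorph_prodMatrix_eq (hT : (List.ofFn T).prod = 1) :
    (prodMatrix T).map (comorph T) =
      (∏ i, (genD T * genZ T i).det) • (1 : Matrix (Fin n) (Fin n) (GroupPoly T)) := by
  rw [map_comorph_prodMatrix]
  set D := genD T with hD
  -- each factor is `det Zᵢ • (D Tᵢ adj D)`
  have hterm : ∀ i, D * genZ T i * (T i).map C * (D * genZ T i).adjugate =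
      (genZ T i).det • (D * (T i).map C * D.adjugate) := by
    intro i
    rw [Matrix.adjugate_mul_distrib,
      show D * genZ T i * (T i).map C * ((genZ T i).adjugate * D.adjugate) =
        D * (genZ T i * (T i).map C) * (genZ T i).adjugate * D.adjugate by simp only [mul_assoc],
      genZ_mul_map,
      show D * ((T i).map C * genZ T i) * (genZ T i).adjugate * D.adjugate =
        D * (T i).map C * (genZ T i * (genZ T i).adjugate) * D.adjugate by simp only [mul_assoc],
      Matrix.mul_adjugate, Matrix.mul_smul, Matrix.mul_one, Matrix.smul_mul]
  simp_rw [hterm]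
  rw [List.ofFn_eq_map, list_prod_map_smul, ← List.ofFn_eq_map, ← List.ofFn_eq_map, List.prod_ofFn]
  -- `P = ∏ᵢ D Tᵢ adj D` satisfies `P D = (det D)^r • D`, hence `P = (det D)^r • 1`
  have hPD : (List.ofFn fun i => D * (T i).map C * D.adjugate).prod * D = D.det ^ r • D := by
    have h := list_prod_map_conj_adjugate_mul D (List.ofFn fun i => (T i).map (C : K →+* GroupPoly T))
    rw [List.map_ofFn, List.length_ofFn, prod_map_C T hT, mul_one] at h
    exact h
  have hP : (List.ofFn fun i => D * (T i).map C * D.adjugate).prod =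
      D.det ^ r • (1 : Matrix (Fin n) (Fin n) (GroupPoly T)) := by
    have h2 := congrArg (· * D.adjugate) hPD
    rw [mul_assoc, Matrix.mul_adjugate, Matrix.smul_mul, Matrix.mul_adjugate, Matrix.mul_smul,
      Matrix.mul_one, smul_comm] at h2
    exact smul_right_injective (Matrix (Fin n) (Fin n) (GroupPoly T)) (det_genD_ne_zero T) h2
  rw [hP, smul_smul]
  congr 1
  rw [Finset.prod_congr rfl fun i _ => Matrix.det_mul D (genZ T i), Finset.prod_mul_distrib,
    Finset.prod_const, Finset.card_univ, Fintype.card_fin, mul_comm]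

/-- Hence `φ*` kills the equations of `Y`: `φ*(M_{jk} - f δ_{jk}) = 0`. [folklore] -/
theorem comorph_prodMatrix_sub (hT : (List.ofFn T).prod = 1) (j k : Fin n) :
    comorph T (prodMatrix T j k -
      detProd K r n * (1 : Matrix (Fin n) (Fin n) (TuplePoly K r n)) j k) = 0 := by
  have h := congrFun (congrFun (map_comorph_prodMatrix_eq T hT) j) k
  rw [Matrix.map_apply, Matrix.smul_apply, smul_eq_mul] at h
  rw [map_sub, map_mul, h, comorph_detProd, sub_eq_zero, Matrix.one_apply, Matrix.one_apply]
  split_ifs <;> simp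

/-- The fibre equations lie in `ker φ*`. [folklore] -/
theorem span_fibreGens_le_ker [DecidableEq (TuplePoly K r n)] (hT : (List.ofFn T).prod = 1)
    (e : Fin n) :
    Ideal.span (fibreGens T e : Set (TuplePoly K r n)) ≤ RingHom.ker (comorph T) := by
  rw [Ideal.span_le]
  intro g hg
  rw [Finset.mem_coe, fibreGens, Finset.mem_image] at hg
  obtain ⟨jk, -, rfl⟩ := hg
  rw [SetLike.mem_coe, RingHom.mem_ker]
  exact comorph_prodMatrix_sub T hT jk.1 jk.2

/-- `f ∉ ker φ*`. [folklore] -/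
theorem detProd_not_mem_ker : detProd K r n ∉ RingHom.ker (comorph T) := by
  rw [RingHom.mem_ker]
  exact comorph_detProd_ne_zero T

/-! ### `K`-points of `M_n^r` -/

/-- The tuple of matrices `(Cᵢ)ᵢ` whose entries are the coordinates of a point `x ∈ K^{r n²}`.
[folklore] -/
def pointMatrix (x : TupleVars r n → K) (i : Fin r) : Matrix (Fin n) (Fin n) K :=
  Matrix.of fun j k => x (i, j, k)

end RigidTuple

end Literature.AlgebraicGeometry.Motives

end
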